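/-
Copyright: the b2b-balaban T⁴-continuum CRUX team, row NE7b OWNER lineage `t4-ne7b-p1` (gen 142). Project licence.
-/
import Summits.QuantumFields.BalabanUV.T4Continuum.Spine.NE7b.SupFifthCumulantCutBounds
import Summits.QuantumFields.BalabanUV.T4Continuum.Spine.NE7b.SupFifthCumulantCutAlgebra
import Summits.QuantumFields.BalabanUV.T4Continuum.Spine.NE7b.SupFourthCumulantCutBounds

/-!
# THE SINGLE CUT OF THE FIFTH CUMULANT, END TO END (SCOPING (d14)(2)(ii), sixth analytic order-five file — the order-5 analogue of (494)).  In the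
# abstract Gibbs format, five class observables centred AT THEIR MEANS (`f_i = F_i − E_νF_i`), with decaying crossing forms `B(a_i,a_j) ≤ K∕r_{ij}²⁴`
# (`r ≥ 1`) and centred moments `≤ M₂, M₄, M₆`, have fifth cumulant `u₅ = E[Πf] − Σ_{a,b}E[f_af_b]·E[f_cf_df_e]` bounded ACROSS THE CUT
# `{1}|{2,3,4,5}` by
#   `|u₅| ≤ (4K + 5M₆ + M₂M₄ + 2K(M₂+M₄) + 24M₂√(KM₄))∕min(r₁₂,r₁₃,r₁₄,r₁₅)⁶`:
# (540)'s triangle `|u₅| ≤ |M| + Σ|P||T|`; `M` by (545); the four CROSSING pairings `|E f₁f_j| ≤ K∕r²⁴ ≤ K∕r_min⁶` ((491)) against far triple moments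
# `≤ (M₂+M₄)∕2`; the six inside pairings `≤ M₂` against STRADDLING third cumulants `|E f₁f_lf_m| ≤ 2√(2(B(a₁,a_l)+B(a₁,a_m))M₄) ≤ 4√(KM₄)∕r_min⁶` ((461)).
# The other four single cuts by relabelling; the pair–triple cuts are the next file (row NE7b, node U5c; (545) `single_cut_bound5`, (540)
# `abs_u5_le_single_cut`, (491) `pairing_abs_le`∕`decay_le_min_pow`, (461) `third_cumulant_le`, (486) `abs_expect_pair_le`, (543) BY NAME; [folklore])

Cell `pub-balaban`, sub-cell `t4`, spine estimate NE7b (`T4WeightBudget.RelWeightBound`; the cell's OWN estimate — NOT PRINTED in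
[Bałaban 1983–89], NOT PROVED).  Crux-route work under `Spine/NE7b/` by the row OWNER (`t4-ne7b-p1` gen 142, file (546)) under FREEZE
(0)'s crux-prover clause; NOTHING of Bałaban's is named as a Lean object, valued or asserted; no `T4Continuum/Support` leaf typed; no
`def`, no notation (`u₅` WRITTEN OUT: twenty-one integrals); zero `sorry`.  Imports (BY NAME): the OWNER's (545) `…SupFifthCumulantCutBounds`, (540)
`…SupFifthCumulantCutAlgebra`, (491) `…SupFourthCumulantCutBounds`; (461), (486), (543) through them.

WHAT IS PROVED ([folklore]): §1 `bilinear_pair_split`, `sqrt_step`, `abs_expect_triple_le`; §2 THE END **`fifth_cumulant_single_cut`**; §3 toy.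

HONEST (what this is NOT).  One cut shape of fifteen (the other single cuts by relabelling; the ten pair–triple cuts are the successor's next file),
then (539)'s threshold, the whitened instantiation and the kernel letter by (538); the cumulant FORM of `∂⁵W` is NOT typed; scalar skeleton ((A3),
NC-NE7b-α UNRULED); nothing of Bałaban's asserted.  BY-NAME EFFECT ON THE WALL: NONE.  NE7b NOT PRINTED ∕ NOT PROVED; spine PROVED 0∕9; rung (B)+1
— FINITE-torus statements; NOT the mass gap, NOT Clay.  HONEST DEPENDENCY: continuum YM on T⁴ ⇐ BetaPertH ∧ nine spine estimates (0∕9 proved);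
BetaPertH ⇐ (D1) ∧ (D4) ∧ CAP+tail; G-an2-4 gates asym, D1 and NE2∕3∕4.
-/

set_option autoImplicit false

noncomputable section

namespace Summit.QuantumFields.BalabanUV.T4Continuum.NE7b.SupFifthCumulantSingleCuts

open MeasureTheory Real Set Function Finset
open scoped BigOperators
open SupTruncationGroupBound (abs_expect_pair_le integrable_sq_of_quartic)
open SupTruncationFiveMoments (abs_triple_le' integrable_triple')
open SupDobrushinThirdCumulant (third_cumulant_le)
open SupFourthCumulantCutBounds (pairing_abs_le decay_le_min_pow)
open SupFifthCumulantCutAlgebra (abs_u5_le_single_cut)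
open SupFifthCumulantCutBounds (single_cut_bound5)

/-! ## §1. Helpers -/

section Helpers

variable {ι : Type} [Fintype ι]

/-- `Σ_w A_w(B_w + H_w)∕c_w = Σ_w A_wB_w∕c_w + Σ_w A_wH_w∕c_w`. [folklore] -/
theorem bilinear_pair_split (A B H c : ι → ℝ) : ∑ w, A w * (B w + H w) / c w = (∑ w, A w * B w / c w) + ∑ w, A w * H w / c w := by
  rw [← Finset.sum_add_distrib]
  exact Finset.sum_congr rfl fun w _ => by ring

end Helpers

/-- **The square-root step**: `S ≤ 2K∕r²⁴`, `r ≥ 1`, `K, M₄ ≥ 0` give `2√(2·S·M₄) ≤ 4√(KM₄)∕r⁶`. [folklore] -/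
theorem sqrt_step {K M₄ rm S : ℝ} (hK : 0 ≤ K) (hM : 0 ≤ M₄) (hrm1 : 1 ≤ rm) (hS : S ≤ 2 * K / rm ^ 24) :
    2 * Real.sqrt (2 * S * M₄) ≤ 4 * Real.sqrt (K * M₄) / rm ^ 6 := by
  have hrm0 : 0 < rm := by linarith
  have h1 : 2 * S * M₄ ≤ 4 * (K * M₄) / rm ^ 24 := by
    have := mul_le_mul_of_nonneg_right hS hM
    calc 2 * S * M₄ = 2 * (S * M₄) := by ring
      _ ≤ 2 * (2 * K / rm ^ 24 * M₄) := by linarith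
      _ = 4 * (K * M₄) / rm ^ 24 := by ring
  have h2 : 4 * (K * M₄) / rm ^ 24 ≤ 4 * (K * M₄) / rm ^ 12 :=
    div_le_div_of_nonneg_left (by positivity) (by positivity) (pow_le_pow_right₀ hrm1 (by norm_num))
  have hsq : (2 * Real.sqrt (K * M₄) / rm ^ 6) ^ 2 = 4 * (K * M₄) / rm ^ 12 := by
    rw [div_pow, mul_pow, Real.sq_sqrt (mul_nonneg hK hM)]; ring
  have h3 : Real.sqrt (2 * S * M₄) ≤ 2 * Real.sqrt (K * M₄) / rm ^ 6 := by
    have h := Real.sqrt_le_sqrt ((h1.trans h2).trans (le_of_eq hsq.symm))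
    rwa [Real.sqrt_sq (by positivity)] at h
  calc 2 * Real.sqrt (2 * S * M₄) ≤ 2 * (2 * Real.sqrt (K * M₄) / rm ^ 6) := by linarith
    _ = 4 * Real.sqrt (K * M₄) / rm ^ 6 := by ring

section Moments

variable {Ω : Type*} [MeasurableSpace Ω] {μ : Measure Ω} {f g h : Ω → ℝ}

/-- **The triple moment**: `|∫fgh| ≤ (∫f² + (∫g⁴ + ∫h⁴)∕2)∕2` (fourth moments). [folklore] -/
theorem abs_expect_triple_le [IsProbabilityMeasure μ] (hf : Measurable f) (hg : Measurable g) (hh : Measurable h)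
    (hf4 : Integrable (fun ω => f ω ^ 4) μ) (hg4 : Integrable (fun ω => g ω ^ 4) μ) (hh4 : Integrable (fun ω => h ω ^ 4) μ) :
    |∫ ω, f ω * g ω * h ω ∂μ| ≤ ((∫ ω, f ω ^ 2 ∂μ) + ((∫ ω, g ω ^ 4 ∂μ) + (∫ ω, h ω ^ 4 ∂μ)) / 2) / 2 := by
  have hf2 := integrable_sq_of_quartic hf hf4
  have hgh : Integrable (fun ω => (g ω ^ 4 + h ω ^ 4) / 2) μ := (hg4.add hh4).div_const 2
  have hb : Integrable (fun ω => (f ω ^ 2 + (g ω ^ 4 + h ω ^ 4) / 2) / 2) μ := (hf2.add hgh).div_const 2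
  have _h := integrable_triple' hf hg hh hf4 hg4 hh4
  refine (abs_integral_le_integral_abs).trans ((integral_mono_of_nonneg (ae_of_all _ fun ω => abs_nonneg _) hb
    (ae_of_all _ fun ω => ?_)).trans (le_of_eq ?_))
  · simpa using abs_triple_le' (f ω) (g ω) (h ω)
  · rw [integral_div, integral_add hf2 hgh, integral_div, integral_add hg4 hh4]

end Moments

/-! ## §2. THE END: the single cut -/

variable {ι : Type} [Fintype ι] [DecidableEq ι]

variable {V : (ι → ℝ) → ℝ} {V₁ : ι → (ι → ℝ) → ℝ} {c : ι → ℝ} {Cw γ : ℝ} {J D : ι → ι → ℝ}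
  {P : ι → ((ι → ℝ) → ℝ) → ((ι → ℝ) → ℝ)} {F₁ F₂ F₃ F₄ F₅ : (ι → ℝ) → ℝ} {a₁ a₂ a₃ a₄ a₅ : ι → ℝ}

set_option maxHeartbeats 400000 in
/-- **THE END — THE SINGLE CUT `{1}|{2,3,4,5}` OF THE FIFTH CUMULANT** (mean-centred class observables, decaying crossing forms, centred moments
`≤ M₂, M₄, M₆`): `|u₅| ≤ (4K + 5M₆ + M₂M₄ + 2K(M₂+M₄) + 24M₂√(KM₄))∕min(r₁₂,r₁₃,r₁₄,r₁₅)⁶`. [folklore] -/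
theorem fifth_cumulant_single_cut
    (hP : ∀ x F ω, P x F ω = (∫ s, F (update ω x s) * exp (-V (update ω x s))) / ∫ s, exp (-V (update ω x s)))
    (hV : ∀ x ω, HasDerivAt (fun s => V (update ω x s)) (V₁ x ω) (ω x))
    (hfloor : ∀ x ω s t, c x * (s - t) ^ 2 ≤ (V₁ x (update ω x s) - V₁ x (update ω x t)) * (s - t)) (hc : ∀ x, 0 < c x)
    (hceil : ∀ x ω s t, |V₁ x (update ω x s) - V₁ x (update ω x t)| ≤ Cw * |s - t|)
    (hcross : ∀ x z, z ≠ x → ∀ ω s t, |V₁ x (update ω z s) - V₁ x (update ω z t)| ≤ J x z * |s - t|) (hVc : Continuous V)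
    (hV0 : Integrable (fun ω : ι → ℝ => exp (-V ω))) (hV2 : ∀ z, Integrable (fun ω : ι → ℝ => ω z ^ 2 * exp (-V ω)))
    (hJ : ∀ x z, 0 ≤ J x z) (hJ0 : ∀ x, J x x = 0) (hrow : ∀ x, ∑ z, J x z / c x ≤ γ) (hγ0 : 0 ≤ γ) (hγ1 : γ < 1)
    (hD : ∀ x y, 0 ≤ D x y) (hDC : ∀ x y, (if x = y then (1 : ℝ) else 0) + ∑ z, D x z * (J z y / c z) ≤ D x y)
    (h1 : ∀ z ω s t, |F₁ (update ω z s) - F₁ (update ω z t)| ≤ a₁ z * |s - t|)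
    (h2 : ∀ z ω s t, |F₂ (update ω z s) - F₂ (update ω z t)| ≤ a₂ z * |s - t|)
    (h3 : ∀ z ω s t, |F₃ (update ω z s) - F₃ (update ω z t)| ≤ a₃ z * |s - t|)
    (h4 : ∀ z ω s t, |F₄ (update ω z s) - F₄ (update ω z t)| ≤ a₄ z * |s - t|)
    (h5 : ∀ z ω s t, |F₅ (update ω z s) - F₅ (update ω z t)| ≤ a₅ z * |s - t|)
    {K r12 r13 r14 r15 M₂ M₄ M₆ : ℝ} (hK : 0 ≤ K) (hr12 : 1 ≤ r12) (hr13 : 1 ≤ r13) (hr14 : 1 ≤ r14) (hr15 : 1 ≤ r15)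
    (hB12 : (∑ w, (∑ z, D z w * a₁ z) * (∑ z, D z w * a₂ z) / c w) ≤ K / r12 ^ 24) (hB13 : (∑ w, (∑ z, D z w * a₁ z) * (∑ z, D z w * a₃ z) / c w) ≤ K
        / r13 ^ 24)
    (hB14 : (∑ w, (∑ z, D z w * a₁ z) * (∑ z, D z w * a₄ z) / c w) ≤ K / r14 ^ 24) (hB15 : (∑ w, (∑ z, D z w * a₁ z) * (∑ z, D z w * a₅ z) / c w) ≤ K
        / r15 ^ 24)
    (hq1 : Integrable (fun ω => (F₁ ω - (∫ ω', F₁ ω' ∂((volume : Measure (ι → ℝ)).tilted fun ω => -V ω))) ^ 4) ((volume : Measure (ι → ℝ)).tilted fun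
        ω => -V ω))
    (hq2 : Integrable (fun ω => (F₂ ω - (∫ ω', F₂ ω' ∂((volume : Measure (ι → ℝ)).tilted fun ω => -V ω))) ^ 4) ((volume : Measure (ι → ℝ)).tilted fun
        ω => -V ω))
    (hq3 : Integrable (fun ω => (F₃ ω - (∫ ω', F₃ ω' ∂((volume : Measure (ι → ℝ)).tilted fun ω => -V ω))) ^ 4) ((volume : Measure (ι → ℝ)).tilted fun
        ω => -V ω))
    (hq4 : Integrable (fun ω => (F₄ ω - (∫ ω', F₄ ω' ∂((volume : Measure (ι → ℝ)).tilted fun ω => -V ω))) ^ 4) ((volume : Measure (ι → ℝ)).tilted fun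
        ω => -V ω))
    (hq5 : Integrable (fun ω => (F₅ ω - (∫ ω', F₅ ω' ∂((volume : Measure (ι → ℝ)).tilted fun ω => -V ω))) ^ 4) ((volume : Measure (ι → ℝ)).tilted fun
        ω => -V ω))
    (hs1 : Integrable (fun ω => (F₁ ω - (∫ ω', F₁ ω' ∂((volume : Measure (ι → ℝ)).tilted fun ω => -V ω))) ^ 6) ((volume : Measure (ι → ℝ)).tilted fun
        ω => -V ω))
    (hs2 : Integrable (fun ω => (F₂ ω - (∫ ω', F₂ ω' ∂((volume : Measure (ι → ℝ)).tilted fun ω => -V ω))) ^ 6) ((volume : Measure (ι → ℝ)).tilted fun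
        ω => -V ω))
    (hs3 : Integrable (fun ω => (F₃ ω - (∫ ω', F₃ ω' ∂((volume : Measure (ι → ℝ)).tilted fun ω => -V ω))) ^ 6) ((volume : Measure (ι → ℝ)).tilted fun
        ω => -V ω))
    (hs4 : Integrable (fun ω => (F₄ ω - (∫ ω', F₄ ω' ∂((volume : Measure (ι → ℝ)).tilted fun ω => -V ω))) ^ 6) ((volume : Measure (ι → ℝ)).tilted fun
        ω => -V ω))
    (hs5 : Integrable (fun ω => (F₅ ω - (∫ ω', F₅ ω' ∂((volume : Measure (ι → ℝ)).tilted fun ω => -V ω))) ^ 6) ((volume : Measure (ι → ℝ)).tilted fun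
        ω => -V ω))
    (hM21 : ∫ ω, (F₁ ω - (∫ ω', F₁ ω' ∂((volume : Measure (ι → ℝ)).tilted fun ω => -V ω))) ^ 2 ∂((volume : Measure (ι → ℝ)).tilted fun ω => -V ω) ≤
        M₂)
    (hM22 : ∫ ω, (F₂ ω - (∫ ω', F₂ ω' ∂((volume : Measure (ι → ℝ)).tilted fun ω => -V ω))) ^ 2 ∂((volume : Measure (ι → ℝ)).tilted fun ω => -V ω) ≤
        M₂)
    (hM23 : ∫ ω, (F₃ ω - (∫ ω', F₃ ω' ∂((volume : Measure (ι → ℝ)).tilted fun ω => -V ω))) ^ 2 ∂((volume : Measure (ι → ℝ)).tilted fun ω => -V ω) ≤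
        M₂)
    (hM24 : ∫ ω, (F₄ ω - (∫ ω', F₄ ω' ∂((volume : Measure (ι → ℝ)).tilted fun ω => -V ω))) ^ 2 ∂((volume : Measure (ι → ℝ)).tilted fun ω => -V ω) ≤
        M₂)
    (hM25 : ∫ ω, (F₅ ω - (∫ ω', F₅ ω' ∂((volume : Measure (ι → ℝ)).tilted fun ω => -V ω))) ^ 2 ∂((volume : Measure (ι → ℝ)).tilted fun ω => -V ω) ≤
        M₂)
    (hM41 : ∫ ω, (F₁ ω - (∫ ω', F₁ ω' ∂((volume : Measure (ι → ℝ)).tilted fun ω => -V ω))) ^ 4 ∂((volume : Measure (ι → ℝ)).tilted fun ω => -V ω) ≤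
        M₄)
    (hM42 : ∫ ω, (F₂ ω - (∫ ω', F₂ ω' ∂((volume : Measure (ι → ℝ)).tilted fun ω => -V ω))) ^ 4 ∂((volume : Measure (ι → ℝ)).tilted fun ω => -V ω) ≤
        M₄)
    (hM43 : ∫ ω, (F₃ ω - (∫ ω', F₃ ω' ∂((volume : Measure (ι → ℝ)).tilted fun ω => -V ω))) ^ 4 ∂((volume : Measure (ι → ℝ)).tilted fun ω => -V ω) ≤
        M₄)
    (hM44 : ∫ ω, (F₄ ω - (∫ ω', F₄ ω' ∂((volume : Measure (ι → ℝ)).tilted fun ω => -V ω))) ^ 4 ∂((volume : Measure (ι → ℝ)).tilted fun ω => -V ω) ≤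
        M₄)
    (hM45 : ∫ ω, (F₅ ω - (∫ ω', F₅ ω' ∂((volume : Measure (ι → ℝ)).tilted fun ω => -V ω))) ^ 4 ∂((volume : Measure (ι → ℝ)).tilted fun ω => -V ω) ≤
        M₄)
    (hM61 : ∫ ω, (F₁ ω - (∫ ω', F₁ ω' ∂((volume : Measure (ι → ℝ)).tilted fun ω => -V ω))) ^ 6 ∂((volume : Measure (ι → ℝ)).tilted fun ω => -V ω) ≤
        M₆)
    (hM62 : ∫ ω, (F₂ ω - (∫ ω', F₂ ω' ∂((volume : Measure (ι → ℝ)).tilted fun ω => -V ω))) ^ 6 ∂((volume : Measure (ι → ℝ)).tilted fun ω => -V ω) ≤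
        M₆)
    (hM63 : ∫ ω, (F₃ ω - (∫ ω', F₃ ω' ∂((volume : Measure (ι → ℝ)).tilted fun ω => -V ω))) ^ 6 ∂((volume : Measure (ι → ℝ)).tilted fun ω => -V ω) ≤
        M₆)
    (hM64 : ∫ ω, (F₄ ω - (∫ ω', F₄ ω' ∂((volume : Measure (ι → ℝ)).tilted fun ω => -V ω))) ^ 6 ∂((volume : Measure (ι → ℝ)).tilted fun ω => -V ω) ≤
        M₆)
    (hM65 : ∫ ω, (F₅ ω - (∫ ω', F₅ ω' ∂((volume : Measure (ι → ℝ)).tilted fun ω => -V ω))) ^ 6 ∂((volume : Measure (ι → ℝ)).tilted fun ω => -V ω) ≤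
        M₆) :
    |(∫ ω, (F₁ ω - (∫ ω', F₁ ω' ∂((volume : Measure (ι → ℝ)).tilted fun ω => -V ω))) * (F₂ ω - (∫ ω', F₂ ω' ∂((volume : Measure (ι → ℝ)).tilted fun ω
        => -V ω))) * (F₃ ω - (∫ ω', F₃ ω' ∂((volume : Measure (ι → ℝ)).tilted fun ω => -V ω))) * (F₄ ω - (∫ ω', F₄ ω' ∂((volume : Measure (ι →
        ℝ)).tilted fun ω => -V ω))) * (F₅ ω - (∫ ω', F₅ ω' ∂((volume : Measure (ι → ℝ)).tilted fun ω => -V ω))) ∂((volume : Measure (ι → ℝ)).tilted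
        fun ω => -V ω)) -
        ((∫ ω, (F₁ ω - (∫ ω', F₁ ω' ∂((volume : Measure (ι → ℝ)).tilted fun ω => -V ω))) * (F₂ ω - (∫ ω', F₂ ω' ∂((volume : Measure (ι → ℝ)).tilted
            fun ω => -V ω))) ∂((volume : Measure (ι → ℝ)).tilted fun ω => -V ω)) * (∫ ω, (F₃ ω - (∫ ω', F₃ ω' ∂((volume : Measure (ι → ℝ)).tilted fun
            ω => -V ω))) * (F₄ ω - (∫ ω', F₄ ω' ∂((volume : Measure (ι → ℝ)).tilted fun ω => -V ω))) * (F₅ ω - (∫ ω', F₅ ω' ∂((volume : Measure (ι →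
            ℝ)).tilted fun ω => -V ω))) ∂((volume : Measure (ι → ℝ)).tilted fun ω => -V ω)) +
        (∫ ω, (F₁ ω - (∫ ω', F₁ ω' ∂((volume : Measure (ι → ℝ)).tilted fun ω => -V ω))) * (F₃ ω - (∫ ω', F₃ ω' ∂((volume : Measure (ι → ℝ)).tilted
            fun ω => -V ω))) ∂((volume : Measure (ι → ℝ)).tilted fun ω => -V ω)) * (∫ ω, (F₂ ω - (∫ ω', F₂ ω' ∂((volume : Measure (ι → ℝ)).tilted fun
            ω => -V ω))) * (F₄ ω - (∫ ω', F₄ ω' ∂((volume : Measure (ι → ℝ)).tilted fun ω => -V ω))) * (F₅ ω - (∫ ω', F₅ ω' ∂((volume : Measure (ι →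
            ℝ)).tilted fun ω => -V ω))) ∂((volume : Measure (ι → ℝ)).tilted fun ω => -V ω)) +
        (∫ ω, (F₁ ω - (∫ ω', F₁ ω' ∂((volume : Measure (ι → ℝ)).tilted fun ω => -V ω))) * (F₄ ω - (∫ ω', F₄ ω' ∂((volume : Measure (ι → ℝ)).tilted
            fun ω => -V ω))) ∂((volume : Measure (ι → ℝ)).tilted fun ω => -V ω)) * (∫ ω, (F₂ ω - (∫ ω', F₂ ω' ∂((volume : Measure (ι → ℝ)).tilted fun
            ω => -V ω))) * (F₃ ω - (∫ ω', F₃ ω' ∂((volume : Measure (ι → ℝ)).tilted fun ω => -V ω))) * (F₅ ω - (∫ ω', F₅ ω' ∂((volume : Measure (ι →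
            ℝ)).tilted fun ω => -V ω))) ∂((volume : Measure (ι → ℝ)).tilted fun ω => -V ω)) +
        (∫ ω, (F₁ ω - (∫ ω', F₁ ω' ∂((volume : Measure (ι → ℝ)).tilted fun ω => -V ω))) * (F₅ ω - (∫ ω', F₅ ω' ∂((volume : Measure (ι → ℝ)).tilted
            fun ω => -V ω))) ∂((volume : Measure (ι → ℝ)).tilted fun ω => -V ω)) * (∫ ω, (F₂ ω - (∫ ω', F₂ ω' ∂((volume : Measure (ι → ℝ)).tilted fun
            ω => -V ω))) * (F₃ ω - (∫ ω', F₃ ω' ∂((volume : Measure (ι → ℝ)).tilted fun ω => -V ω))) * (F₄ ω - (∫ ω', F₄ ω' ∂((volume : Measure (ι →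
            ℝ)).tilted fun ω => -V ω))) ∂((volume : Measure (ι → ℝ)).tilted fun ω => -V ω)) +
        (∫ ω, (F₂ ω - (∫ ω', F₂ ω' ∂((volume : Measure (ι → ℝ)).tilted fun ω => -V ω))) * (F₃ ω - (∫ ω', F₃ ω' ∂((volume : Measure (ι → ℝ)).tilted
            fun ω => -V ω))) ∂((volume : Measure (ι → ℝ)).tilted fun ω => -V ω)) * (∫ ω, (F₁ ω - (∫ ω', F₁ ω' ∂((volume : Measure (ι → ℝ)).tilted fun
            ω => -V ω))) * (F₄ ω - (∫ ω', F₄ ω' ∂((volume : Measure (ι → ℝ)).tilted fun ω => -V ω))) * (F₅ ω - (∫ ω', F₅ ω' ∂((volume : Measure (ι →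
            ℝ)).tilted fun ω => -V ω))) ∂((volume : Measure (ι → ℝ)).tilted fun ω => -V ω)) +
        (∫ ω, (F₂ ω - (∫ ω', F₂ ω' ∂((volume : Measure (ι → ℝ)).tilted fun ω => -V ω))) * (F₄ ω - (∫ ω', F₄ ω' ∂((volume : Measure (ι → ℝ)).tilted
            fun ω => -V ω))) ∂((volume : Measure (ι → ℝ)).tilted fun ω => -V ω)) * (∫ ω, (F₁ ω - (∫ ω', F₁ ω' ∂((volume : Measure (ι → ℝ)).tilted fun
            ω => -V ω))) * (F₃ ω - (∫ ω', F₃ ω' ∂((volume : Measure (ι → ℝ)).tilted fun ω => -V ω))) * (F₅ ω - (∫ ω', F₅ ω' ∂((volume : Measure (ι →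
            ℝ)).tilted fun ω => -V ω))) ∂((volume : Measure (ι → ℝ)).tilted fun ω => -V ω)) +
        (∫ ω, (F₂ ω - (∫ ω', F₂ ω' ∂((volume : Measure (ι → ℝ)).tilted fun ω => -V ω))) * (F₅ ω - (∫ ω', F₅ ω' ∂((volume : Measure (ι → ℝ)).tilted
            fun ω => -V ω))) ∂((volume : Measure (ι → ℝ)).tilted fun ω => -V ω)) * (∫ ω, (F₁ ω - (∫ ω', F₁ ω' ∂((volume : Measure (ι → ℝ)).tilted fun
            ω => -V ω))) * (F₃ ω - (∫ ω', F₃ ω' ∂((volume : Measure (ι → ℝ)).tilted fun ω => -V ω))) * (F₄ ω - (∫ ω', F₄ ω' ∂((volume : Measure (ι →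
            ℝ)).tilted fun ω => -V ω))) ∂((volume : Measure (ι → ℝ)).tilted fun ω => -V ω)) +
        (∫ ω, (F₃ ω - (∫ ω', F₃ ω' ∂((volume : Measure (ι → ℝ)).tilted fun ω => -V ω))) * (F₄ ω - (∫ ω', F₄ ω' ∂((volume : Measure (ι → ℝ)).tilted
            fun ω => -V ω))) ∂((volume : Measure (ι → ℝ)).tilted fun ω => -V ω)) * (∫ ω, (F₁ ω - (∫ ω', F₁ ω' ∂((volume : Measure (ι → ℝ)).tilted fun
            ω => -V ω))) * (F₂ ω - (∫ ω', F₂ ω' ∂((volume : Measure (ι → ℝ)).tilted fun ω => -V ω))) * (F₅ ω - (∫ ω', F₅ ω' ∂((volume : Measure (ι →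
            ℝ)).tilted fun ω => -V ω))) ∂((volume : Measure (ι → ℝ)).tilted fun ω => -V ω)) +
        (∫ ω, (F₃ ω - (∫ ω', F₃ ω' ∂((volume : Measure (ι → ℝ)).tilted fun ω => -V ω))) * (F₅ ω - (∫ ω', F₅ ω' ∂((volume : Measure (ι → ℝ)).tilted
            fun ω => -V ω))) ∂((volume : Measure (ι → ℝ)).tilted fun ω => -V ω)) * (∫ ω, (F₁ ω - (∫ ω', F₁ ω' ∂((volume : Measure (ι → ℝ)).tilted fun
            ω => -V ω))) * (F₂ ω - (∫ ω', F₂ ω' ∂((volume : Measure (ι → ℝ)).tilted fun ω => -V ω))) * (F₄ ω - (∫ ω', F₄ ω' ∂((volume : Measure (ι →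
            ℝ)).tilted fun ω => -V ω))) ∂((volume : Measure (ι → ℝ)).tilted fun ω => -V ω)) +
        (∫ ω, (F₄ ω - (∫ ω', F₄ ω' ∂((volume : Measure (ι → ℝ)).tilted fun ω => -V ω))) * (F₅ ω - (∫ ω', F₅ ω' ∂((volume : Measure (ι → ℝ)).tilted
            fun ω => -V ω))) ∂((volume : Measure (ι → ℝ)).tilted fun ω => -V ω)) * (∫ ω, (F₁ ω - (∫ ω', F₁ ω' ∂((volume : Measure (ι → ℝ)).tilted fun
            ω => -V ω))) * (F₂ ω - (∫ ω', F₂ ω' ∂((volume : Measure (ι → ℝ)).tilted fun ω => -V ω))) * (F₃ ω - (∫ ω', F₃ ω' ∂((volume : Measure (ι →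
            ℝ)).tilted fun ω => -V ω))) ∂((volume : Measure (ι → ℝ)).tilted fun ω => -V ω)))| ≤
      (4 * K + 5 * M₆ + M₂ * M₄ + 2 * K * (M₂ + M₄) + 24 * M₂ * Real.sqrt (K * M₄)) / (min r12 (min r13 (min r14 r15))) ^ 6 := by
  set ν : Measure (ι → ℝ) := ((volume : Measure (ι → ℝ)).tilted fun ω => -V ω) with hν
  haveI : IsProbabilityMeasure ν := isProbabilityMeasure_tilted hV0
  set rm : ℝ := min r12 (min r13 (min r14 r15)) with hrm
  have hrm1 : 1 ≤ rm := le_min hr12 (le_min hr13 (le_min hr14 hr15))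
  have hrm0 : 0 < rm := by linarith
  have l12 : rm ≤ r12 := min_le_left _ _
  have l13 : rm ≤ r13 := (min_le_right _ _).trans (min_le_left _ _)
  have l14 : rm ≤ r14 := (min_le_right _ _).trans ((min_le_right _ _).trans (min_le_left _ _))
  have l15 : rm ≤ r15 := (min_le_right _ _).trans ((min_le_right _ _).trans (min_le_right _ _))
  have hM2nn : 0 ≤ M₂ := le_trans (integral_nonneg fun ω => sq_nonneg _) hM21
  have hM4nn : 0 ≤ M₄ := le_trans (integral_nonneg fun ω => by positivity) hM41
  have hm1 : Measurable fun ω => F₁ ω - (∫ ω', F₁ ω' ∂((volume : Measure (ι → ℝ)).tilted fun ω => -V ω)) := (SupCoordinateLipschitzClass.measurable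
      h1).sub_const _
  have hm2 : Measurable fun ω => F₂ ω - (∫ ω', F₂ ω' ∂((volume : Measure (ι → ℝ)).tilted fun ω => -V ω)) := (SupCoordinateLipschitzClass.measurable
      h2).sub_const _
  have hm3 : Measurable fun ω => F₃ ω - (∫ ω', F₃ ω' ∂((volume : Measure (ι → ℝ)).tilted fun ω => -V ω)) := (SupCoordinateLipschitzClass.measurable
      h3).sub_const _
  have hm4 : Measurable fun ω => F₄ ω - (∫ ω', F₄ ω' ∂((volume : Measure (ι → ℝ)).tilted fun ω => -V ω)) := (SupCoordinateLipschitzClass.measurable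
      h4).sub_const _
  have hm5 : Measurable fun ω => F₅ ω - (∫ ω', F₅ ω' ∂((volume : Measure (ι → ℝ)).tilted fun ω => -V ω)) := (SupCoordinateLipschitzClass.measurable
      h5).sub_const _
  -- (545): the straddling five-point moment
  have hM : |(∫ ω, (F₁ ω - (∫ ω', F₁ ω' ∂((volume : Measure (ι → ℝ)).tilted fun ω => -V ω))) * (F₂ ω - (∫ ω', F₂ ω' ∂((volume : Measure (ι →
      ℝ)).tilted fun ω => -V ω))) * (F₃ ω - (∫ ω', F₃ ω' ∂((volume : Measure (ι → ℝ)).tilted fun ω => -V ω))) * (F₄ ω - (∫ ω', F₄ ω' ∂((volume :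
      Measure (ι → ℝ)).tilted fun ω => -V ω))) * (F₅ ω - (∫ ω', F₅ ω' ∂((volume : Measure (ι → ℝ)).tilted fun ω => -V ω))) ∂((volume : Measure (ι →
      ℝ)).tilted fun ω => -V ω))| ≤ (4 * K + 5 * M₆ + M₂ * M₄) / rm ^ 6 :=
    single_cut_bound5 hP hV hfloor hc hceil hcross hVc hV0 hV2 hJ hJ0 hrow hγ0 hγ1 hD hDC h1 h2 h3 h4 h5 (∫ ω', F₂ ω' ∂((volume : Measure (ι →
        ℝ)).tilted fun ω => -V ω)) (∫ ω', F₃ ω' ∂((volume : Measure (ι → ℝ)).tilted fun ω => -V ω)) (∫ ω', F₄ ω' ∂((volume : Measure (ι → ℝ)).tilted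
        fun ω => -V ω)) (∫ ω', F₅ ω' ∂((volume : Measure (ι → ℝ)).tilted fun ω => -V ω)) hK hr12 hr13 hr14 hr15 hB12 hB13 hB14 hB15 hq1 hq2 hq3 hq4
        hq5 hs1 hs2 hs3 hs4 hs5 hM21 hM42 hM43 hM44 hM45 hM61 hM62 hM63 hM64 hM65
  -- (491): the four crossing pairings decay; (486)/(543): the inside pairings and the far triple moments are bounded
  have hP12 : |(∫ ω, (F₁ ω - (∫ ω', F₁ ω' ∂((volume : Measure (ι → ℝ)).tilted fun ω => -V ω))) * (F₂ ω - (∫ ω', F₂ ω' ∂((volume : Measure (ι →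
      ℝ)).tilted fun ω => -V ω))) ∂((volume : Measure (ι → ℝ)).tilted fun ω => -V ω))| ≤ K / rm ^ 6 :=
    (pairing_abs_le hP hV hfloor hc hceil hcross hVc hV0 hV2 hJ hJ0 hrow hγ0 hγ1 hD hDC h1 h2 hB12).trans (decay_le_min_pow hK hrm1 l12)
  have hP13 : |(∫ ω, (F₁ ω - (∫ ω', F₁ ω' ∂((volume : Measure (ι → ℝ)).tilted fun ω => -V ω))) * (F₃ ω - (∫ ω', F₃ ω' ∂((volume : Measure (ι →
      ℝ)).tilted fun ω => -V ω))) ∂((volume : Measure (ι → ℝ)).tilted fun ω => -V ω))| ≤ K / rm ^ 6 :=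
    (pairing_abs_le hP hV hfloor hc hceil hcross hVc hV0 hV2 hJ hJ0 hrow hγ0 hγ1 hD hDC h1 h3 hB13).trans (decay_le_min_pow hK hrm1 l13)
  have hP14 : |(∫ ω, (F₁ ω - (∫ ω', F₁ ω' ∂((volume : Measure (ι → ℝ)).tilted fun ω => -V ω))) * (F₄ ω - (∫ ω', F₄ ω' ∂((volume : Measure (ι →
      ℝ)).tilted fun ω => -V ω))) ∂((volume : Measure (ι → ℝ)).tilted fun ω => -V ω))| ≤ K / rm ^ 6 :=
    (pairing_abs_le hP hV hfloor hc hceil hcross hVc hV0 hV2 hJ hJ0 hrow hγ0 hγ1 hD hDC h1 h4 hB14).trans (decay_le_min_pow hK hrm1 l14)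
  have hP15 : |(∫ ω, (F₁ ω - (∫ ω', F₁ ω' ∂((volume : Measure (ι → ℝ)).tilted fun ω => -V ω))) * (F₅ ω - (∫ ω', F₅ ω' ∂((volume : Measure (ι →
      ℝ)).tilted fun ω => -V ω))) ∂((volume : Measure (ι → ℝ)).tilted fun ω => -V ω))| ≤ K / rm ^ 6 :=
    (pairing_abs_le hP hV hfloor hc hceil hcross hVc hV0 hV2 hJ hJ0 hrow hγ0 hγ1 hD hDC h1 h5 hB15).trans (decay_le_min_pow hK hrm1 l15)
  have hP23 : |(∫ ω, (F₂ ω - (∫ ω', F₂ ω' ∂((volume : Measure (ι → ℝ)).tilted fun ω => -V ω))) * (F₃ ω - (∫ ω', F₃ ω' ∂((volume : Measure (ι →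
      ℝ)).tilted fun ω => -V ω))) ∂((volume : Measure (ι → ℝ)).tilted fun ω => -V ω))| ≤ M₂ :=
    (abs_expect_pair_le (μ := ν) hm2 hm3 hq2 hq3).trans (by linarith [hM22, hM23])
  have hP24 : |(∫ ω, (F₂ ω - (∫ ω', F₂ ω' ∂((volume : Measure (ι → ℝ)).tilted fun ω => -V ω))) * (F₄ ω - (∫ ω', F₄ ω' ∂((volume : Measure (ι →
      ℝ)).tilted fun ω => -V ω))) ∂((volume : Measure (ι → ℝ)).tilted fun ω => -V ω))| ≤ M₂ :=
    (abs_expect_pair_le (μ := ν) hm2 hm4 hq2 hq4).trans (by linarith [hM22, hM24])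
  have hP25 : |(∫ ω, (F₂ ω - (∫ ω', F₂ ω' ∂((volume : Measure (ι → ℝ)).tilted fun ω => -V ω))) * (F₅ ω - (∫ ω', F₅ ω' ∂((volume : Measure (ι →
      ℝ)).tilted fun ω => -V ω))) ∂((volume : Measure (ι → ℝ)).tilted fun ω => -V ω))| ≤ M₂ :=
    (abs_expect_pair_le (μ := ν) hm2 hm5 hq2 hq5).trans (by linarith [hM22, hM25])
  have hP34 : |(∫ ω, (F₃ ω - (∫ ω', F₃ ω' ∂((volume : Measure (ι → ℝ)).tilted fun ω => -V ω))) * (F₄ ω - (∫ ω', F₄ ω' ∂((volume : Measure (ι →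
      ℝ)).tilted fun ω => -V ω))) ∂((volume : Measure (ι → ℝ)).tilted fun ω => -V ω))| ≤ M₂ :=
    (abs_expect_pair_le (μ := ν) hm3 hm4 hq3 hq4).trans (by linarith [hM23, hM24])
  have hP35 : |(∫ ω, (F₃ ω - (∫ ω', F₃ ω' ∂((volume : Measure (ι → ℝ)).tilted fun ω => -V ω))) * (F₅ ω - (∫ ω', F₅ ω' ∂((volume : Measure (ι →
      ℝ)).tilted fun ω => -V ω))) ∂((volume : Measure (ι → ℝ)).tilted fun ω => -V ω))| ≤ M₂ :=
    (abs_expect_pair_le (μ := ν) hm3 hm5 hq3 hq5).trans (by linarith [hM23, hM25])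
  have hP45 : |(∫ ω, (F₄ ω - (∫ ω', F₄ ω' ∂((volume : Measure (ι → ℝ)).tilted fun ω => -V ω))) * (F₅ ω - (∫ ω', F₅ ω' ∂((volume : Measure (ι →
      ℝ)).tilted fun ω => -V ω))) ∂((volume : Measure (ι → ℝ)).tilted fun ω => -V ω))| ≤ M₂ :=
    (abs_expect_pair_le (μ := ν) hm4 hm5 hq4 hq5).trans (by linarith [hM24, hM25])
  have hT345 : |(∫ ω, (F₃ ω - (∫ ω', F₃ ω' ∂((volume : Measure (ι → ℝ)).tilted fun ω => -V ω))) * (F₄ ω - (∫ ω', F₄ ω' ∂((volume : Measure (ι →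
      ℝ)).tilted fun ω => -V ω))) * (F₅ ω - (∫ ω', F₅ ω' ∂((volume : Measure (ι → ℝ)).tilted fun ω => -V ω))) ∂((volume : Measure (ι → ℝ)).tilted fun
      ω => -V ω))| ≤ (M₂ + M₄) / 2 :=
    (abs_expect_triple_le (μ := ν) hm3 hm4 hm5 hq3 hq4 hq5).trans (by linarith [hM23, hM44, hM45])
  have hT245 : |(∫ ω, (F₂ ω - (∫ ω', F₂ ω' ∂((volume : Measure (ι → ℝ)).tilted fun ω => -V ω))) * (F₄ ω - (∫ ω', F₄ ω' ∂((volume : Measure (ι →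
      ℝ)).tilted fun ω => -V ω))) * (F₅ ω - (∫ ω', F₅ ω' ∂((volume : Measure (ι → ℝ)).tilted fun ω => -V ω))) ∂((volume : Measure (ι → ℝ)).tilted fun
      ω => -V ω))| ≤ (M₂ + M₄) / 2 :=
    (abs_expect_triple_le (μ := ν) hm2 hm4 hm5 hq2 hq4 hq5).trans (by linarith [hM22, hM44, hM45])
  have hT235 : |(∫ ω, (F₂ ω - (∫ ω', F₂ ω' ∂((volume : Measure (ι → ℝ)).tilted fun ω => -V ω))) * (F₃ ω - (∫ ω', F₃ ω' ∂((volume : Measure (ι →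
      ℝ)).tilted fun ω => -V ω))) * (F₅ ω - (∫ ω', F₅ ω' ∂((volume : Measure (ι → ℝ)).tilted fun ω => -V ω))) ∂((volume : Measure (ι → ℝ)).tilted fun
      ω => -V ω))| ≤ (M₂ + M₄) / 2 :=
    (abs_expect_triple_le (μ := ν) hm2 hm3 hm5 hq2 hq3 hq5).trans (by linarith [hM22, hM43, hM45])
  have hT234 : |(∫ ω, (F₂ ω - (∫ ω', F₂ ω' ∂((volume : Measure (ι → ℝ)).tilted fun ω => -V ω))) * (F₃ ω - (∫ ω', F₃ ω' ∂((volume : Measure (ι →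
      ℝ)).tilted fun ω => -V ω))) * (F₄ ω - (∫ ω', F₄ ω' ∂((volume : Measure (ι → ℝ)).tilted fun ω => -V ω))) ∂((volume : Measure (ι → ℝ)).tilted fun
      ω => -V ω))| ≤ (M₂ + M₄) / 2 :=
    (abs_expect_triple_le (μ := ν) hm2 hm3 hm4 hq2 hq3 hq4).trans (by linarith [hM22, hM43, hM44])
  -- (461): the six straddling third cumulants decay across the cut
  have hT145 : |(∫ ω, (F₁ ω - (∫ ω', F₁ ω' ∂((volume : Measure (ι → ℝ)).tilted fun ω => -V ω))) * (F₄ ω - (∫ ω', F₄ ω' ∂((volume : Measure (ι →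
      ℝ)).tilted fun ω => -V ω))) * (F₅ ω - (∫ ω', F₅ ω' ∂((volume : Measure (ι → ℝ)).tilted fun ω => -V ω))) ∂((volume : Measure (ι → ℝ)).tilted fun
      ω => -V ω))| ≤ 4 * Real.sqrt (K * M₄) / rm ^ 6 := by
    have h3 := third_cumulant_le hP hV hfloor hc hceil hcross hVc hV0 hV2 hJ hJ0 hrow hγ0 hγ1 hD hDC h1 h4 h5 (∫ ω', F₄ ω' ∂((volume : Measure (ι →
        ℝ)).tilted fun ω => -V ω)) (∫ ω', F₅ ω' ∂((volume : Measure (ι → ℝ)).tilted fun ω => -V ω)) hq1 hq4 hq5 hM41 hM44 hM45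
    have hS : (∑ w, (∑ z, D z w * a₁ z) * ((∑ z, D z w * a₄ z) + ∑ z, D z w * a₅ z) / c w) ≤ 2 * K / rm ^ 24 := by
      rw [bilinear_pair_split]
      have e1 := div_le_div_of_nonneg_left hK (by positivity : (0 : ℝ) < rm ^ 24) (pow_le_pow_left₀ hrm0.le l14 24)
      have e2 := div_le_div_of_nonneg_left hK (by positivity : (0 : ℝ) < rm ^ 24) (pow_le_pow_left₀ hrm0.le l15 24)
      linarith [hB14.trans e1, hB15.trans e2, show 2 * K / rm ^ 24 = K / rm ^ 24 + K / rm ^ 24 from by ring]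
    exact h3.trans (sqrt_step hK hM4nn hrm1 hS)
  have hT135 : |(∫ ω, (F₁ ω - (∫ ω', F₁ ω' ∂((volume : Measure (ι → ℝ)).tilted fun ω => -V ω))) * (F₃ ω - (∫ ω', F₃ ω' ∂((volume : Measure (ι →
      ℝ)).tilted fun ω => -V ω))) * (F₅ ω - (∫ ω', F₅ ω' ∂((volume : Measure (ι → ℝ)).tilted fun ω => -V ω))) ∂((volume : Measure (ι → ℝ)).tilted fun
      ω => -V ω))| ≤ 4 * Real.sqrt (K * M₄) / rm ^ 6 := by
    have h3 := third_cumulant_le hP hV hfloor hc hceil hcross hVc hV0 hV2 hJ hJ0 hrow hγ0 hγ1 hD hDC h1 h3 h5 (∫ ω', F₃ ω' ∂((volume : Measure (ι →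
        ℝ)).tilted fun ω => -V ω)) (∫ ω', F₅ ω' ∂((volume : Measure (ι → ℝ)).tilted fun ω => -V ω)) hq1 hq3 hq5 hM41 hM43 hM45
    have hS : (∑ w, (∑ z, D z w * a₁ z) * ((∑ z, D z w * a₃ z) + ∑ z, D z w * a₅ z) / c w) ≤ 2 * K / rm ^ 24 := by
      rw [bilinear_pair_split]
      have e1 := div_le_div_of_nonneg_left hK (by positivity : (0 : ℝ) < rm ^ 24) (pow_le_pow_left₀ hrm0.le l13 24)
      have e2 := div_le_div_of_nonneg_left hK (by positivity : (0 : ℝ) < rm ^ 24) (pow_le_pow_left₀ hrm0.le l15 24)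
      linarith [hB13.trans e1, hB15.trans e2, show 2 * K / rm ^ 24 = K / rm ^ 24 + K / rm ^ 24 from by ring]
    exact h3.trans (sqrt_step hK hM4nn hrm1 hS)
  have hT134 : |(∫ ω, (F₁ ω - (∫ ω', F₁ ω' ∂((volume : Measure (ι → ℝ)).tilted fun ω => -V ω))) * (F₃ ω - (∫ ω', F₃ ω' ∂((volume : Measure (ι →
      ℝ)).tilted fun ω => -V ω))) * (F₄ ω - (∫ ω', F₄ ω' ∂((volume : Measure (ι → ℝ)).tilted fun ω => -V ω))) ∂((volume : Measure (ι → ℝ)).tilted fun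
      ω => -V ω))| ≤ 4 * Real.sqrt (K * M₄) / rm ^ 6 := by
    have h3 := third_cumulant_le hP hV hfloor hc hceil hcross hVc hV0 hV2 hJ hJ0 hrow hγ0 hγ1 hD hDC h1 h3 h4 (∫ ω', F₃ ω' ∂((volume : Measure (ι →
        ℝ)).tilted fun ω => -V ω)) (∫ ω', F₄ ω' ∂((volume : Measure (ι → ℝ)).tilted fun ω => -V ω)) hq1 hq3 hq4 hM41 hM43 hM44
    have hS : (∑ w, (∑ z, D z w * a₁ z) * ((∑ z, D z w * a₃ z) + ∑ z, D z w * a₄ z) / c w) ≤ 2 * K / rm ^ 24 := by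
      rw [bilinear_pair_split]
      have e1 := div_le_div_of_nonneg_left hK (by positivity : (0 : ℝ) < rm ^ 24) (pow_le_pow_left₀ hrm0.le l13 24)
      have e2 := div_le_div_of_nonneg_left hK (by positivity : (0 : ℝ) < rm ^ 24) (pow_le_pow_left₀ hrm0.le l14 24)
      linarith [hB13.trans e1, hB14.trans e2, show 2 * K / rm ^ 24 = K / rm ^ 24 + K / rm ^ 24 from by ring]
    exact h3.trans (sqrt_step hK hM4nn hrm1 hS)
  have hT125 : |(∫ ω, (F₁ ω - (∫ ω', F₁ ω' ∂((volume : Measure (ι → ℝ)).tilted fun ω => -V ω))) * (F₂ ω - (∫ ω', F₂ ω' ∂((volume : Measure (ι →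
      ℝ)).tilted fun ω => -V ω))) * (F₅ ω - (∫ ω', F₅ ω' ∂((volume : Measure (ι → ℝ)).tilted fun ω => -V ω))) ∂((volume : Measure (ι → ℝ)).tilted fun
      ω => -V ω))| ≤ 4 * Real.sqrt (K * M₄) / rm ^ 6 := by
    have h3 := third_cumulant_le hP hV hfloor hc hceil hcross hVc hV0 hV2 hJ hJ0 hrow hγ0 hγ1 hD hDC h1 h2 h5 (∫ ω', F₂ ω' ∂((volume : Measure (ι →
        ℝ)).tilted fun ω => -V ω)) (∫ ω', F₅ ω' ∂((volume : Measure (ι → ℝ)).tilted fun ω => -V ω)) hq1 hq2 hq5 hM41 hM42 hM45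
    have hS : (∑ w, (∑ z, D z w * a₁ z) * ((∑ z, D z w * a₂ z) + ∑ z, D z w * a₅ z) / c w) ≤ 2 * K / rm ^ 24 := by
      rw [bilinear_pair_split]
      have e1 := div_le_div_of_nonneg_left hK (by positivity : (0 : ℝ) < rm ^ 24) (pow_le_pow_left₀ hrm0.le l12 24)
      have e2 := div_le_div_of_nonneg_left hK (by positivity : (0 : ℝ) < rm ^ 24) (pow_le_pow_left₀ hrm0.le l15 24)
      linarith [hB12.trans e1, hB15.trans e2, show 2 * K / rm ^ 24 = K / rm ^ 24 + K / rm ^ 24 from by ring]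
    exact h3.trans (sqrt_step hK hM4nn hrm1 hS)
  have hT124 : |(∫ ω, (F₁ ω - (∫ ω', F₁ ω' ∂((volume : Measure (ι → ℝ)).tilted fun ω => -V ω))) * (F₂ ω - (∫ ω', F₂ ω' ∂((volume : Measure (ι →
      ℝ)).tilted fun ω => -V ω))) * (F₄ ω - (∫ ω', F₄ ω' ∂((volume : Measure (ι → ℝ)).tilted fun ω => -V ω))) ∂((volume : Measure (ι → ℝ)).tilted fun
      ω => -V ω))| ≤ 4 * Real.sqrt (K * M₄) / rm ^ 6 := by
    have h3 := third_cumulant_le hP hV hfloor hc hceil hcross hVc hV0 hV2 hJ hJ0 hrow hγ0 hγ1 hD hDC h1 h2 h4 (∫ ω', F₂ ω' ∂((volume : Measure (ι →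
        ℝ)).tilted fun ω => -V ω)) (∫ ω', F₄ ω' ∂((volume : Measure (ι → ℝ)).tilted fun ω => -V ω)) hq1 hq2 hq4 hM41 hM42 hM44
    have hS : (∑ w, (∑ z, D z w * a₁ z) * ((∑ z, D z w * a₂ z) + ∑ z, D z w * a₄ z) / c w) ≤ 2 * K / rm ^ 24 := by
      rw [bilinear_pair_split]
      have e1 := div_le_div_of_nonneg_left hK (by positivity : (0 : ℝ) < rm ^ 24) (pow_le_pow_left₀ hrm0.le l12 24)
      have e2 := div_le_div_of_nonneg_left hK (by positivity : (0 : ℝ) < rm ^ 24) (pow_le_pow_left₀ hrm0.le l14 24)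
      linarith [hB12.trans e1, hB14.trans e2, show 2 * K / rm ^ 24 = K / rm ^ 24 + K / rm ^ 24 from by ring]
    exact h3.trans (sqrt_step hK hM4nn hrm1 hS)
  have hT123 : |(∫ ω, (F₁ ω - (∫ ω', F₁ ω' ∂((volume : Measure (ι → ℝ)).tilted fun ω => -V ω))) * (F₂ ω - (∫ ω', F₂ ω' ∂((volume : Measure (ι →
      ℝ)).tilted fun ω => -V ω))) * (F₃ ω - (∫ ω', F₃ ω' ∂((volume : Measure (ι → ℝ)).tilted fun ω => -V ω))) ∂((volume : Measure (ι → ℝ)).tilted fun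
      ω => -V ω))| ≤ 4 * Real.sqrt (K * M₄) / rm ^ 6 := by
    have h3 := third_cumulant_le hP hV hfloor hc hceil hcross hVc hV0 hV2 hJ hJ0 hrow hγ0 hγ1 hD hDC h1 h2 h3 (∫ ω', F₂ ω' ∂((volume : Measure (ι →
        ℝ)).tilted fun ω => -V ω)) (∫ ω', F₃ ω' ∂((volume : Measure (ι → ℝ)).tilted fun ω => -V ω)) hq1 hq2 hq3 hM41 hM42 hM43
    have hS : (∑ w, (∑ z, D z w * a₁ z) * ((∑ z, D z w * a₂ z) + ∑ z, D z w * a₃ z) / c w) ≤ 2 * K / rm ^ 24 := by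
      rw [bilinear_pair_split]
      have e1 := div_le_div_of_nonneg_left hK (by positivity : (0 : ℝ) < rm ^ 24) (pow_le_pow_left₀ hrm0.le l12 24)
      have e2 := div_le_div_of_nonneg_left hK (by positivity : (0 : ℝ) < rm ^ 24) (pow_le_pow_left₀ hrm0.le l13 24)
      linarith [hB12.trans e1, hB13.trans e2, show 2 * K / rm ^ 24 = K / rm ^ 24 + K / rm ^ 24 from by ring]
    exact h3.trans (sqrt_step hK hM4nn hrm1 hS)
  -- the ten products and the assembly by (540)
  have hKr : 0 ≤ K / rm ^ 6 := by positivity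
  have etot : (4 * K + 5 * M₆ + M₂ * M₄ + 2 * K * (M₂ + M₄) + 24 * M₂ * Real.sqrt (K * M₄)) / rm ^ 6 = (4 * K + 5 * M₆ + M₂ * M₄) / rm ^ 6 + 4 * (K /
      rm ^ 6 * ((M₂ + M₄) / 2)) + 6 * (M₂ * (4 * Real.sqrt (K * M₄) / rm ^ 6)) := by ring
  rw [etot]
  refine abs_u5_le_single_cut.trans ?_
  linarith [hM, mul_le_mul hP12 hT345 (abs_nonneg _) hKr, mul_le_mul hP13 hT245 (abs_nonneg _) hKr, mul_le_mul hP14 hT235 (abs_nonneg _) hKr,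
      mul_le_mul hP15 hT234 (abs_nonneg _) hKr, mul_le_mul hP23 hT145 (abs_nonneg _) hM2nn, mul_le_mul hP24 hT135 (abs_nonneg _) hM2nn, mul_le_mul
      hP25 hT134 (abs_nonneg _) hM2nn, mul_le_mul hP34 hT125 (abs_nonneg _) hM2nn, mul_le_mul hP35 hT124 (abs_nonneg _) hM2nn, mul_le_mul hP45 hT123
      (abs_nonneg _) hM2nn]

/-! ## §3. Toy -/

/-- Toy (§1 `sqrt_step` at `K = M₄ = S = 0`, `r = 1`): `0 ≤ 0`. -/
example : 2 * Real.sqrt (2 * 0 * 0) ≤ 4 * Real.sqrt (0 * 0) / (1 : ℝ) ^ 6 := sqrt_step le_rfl le_rfl le_rfl (by norm_num)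

end Summit.QuantumFields.BalabanUV.T4Continuum.NE7b.SupFifthCumulantSingleCuts

end
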